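import Summits.QuantumFields.QCD.Theorems.HeatSlicedQuarksActionBoundsLowModesAbstractCLRAux
import Summits.QuantumFields.QCD.Theorems.HeatSlicedQuarksActionBoundsLowModesStubStaircase
import Summits.QuantumFields.QCD.Theorems.HeatSlicedQuarksActionBoundsLowModesStubBesselCount

/-!
# Stub `stub_abstractCLR` of line `Sketch` (idea `drop-the-wilson-square`): Birman–Schwinger vectors and the
# abstract finite-dimensional CLR inequality (registered stub, lead)
(crux `Summit.QuantumFields.QCD.Theses.HeatSlicedQuarks.ActionBoundsLowModes`, item stmt-QuantumFields-8872,
route route-QuantumFields-HeatSlicedQuarks; lead prover-line-stmt-QuantumFields-8872-0)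

`abstractCLR_of`: the Cwikel-type counting theorem `dim F ≤ 16384 · K · Σ_i W_i²` for a positive definite `T`
with the resolvent local Weyl law `Re((T+E)⁻¹)⁴(i,i) ≤ K/E²`, a weight `W > 0` and a subspace `F` on which
`Re⟨u,Tu⟩ ≤ Σ_i W_i|u_i|²`, PROVED from the two registered engine stubs of the line taken as hypotheses
(`stub_staircase`: the high-energy part of `W^{1/2}T^{-1/2}` has norm ≤ ½ along Cwikel's dyadic staircase;
`stub_besselCount`: min–max-free Hilbert–Schmidt counting).  Ingredients proved here: Minkowski in `ℓ²`,
the square root `S = V diag(√λ) V⋆` as a linear equivalence, the identity `B_lo (S u) = Φ_lo u` for the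
low-energy Birman–Schwinger matrix `B_lo`, its row norms `Σ_j |B_lo(i,j)|² = W_i Σ_{k low} λ_k⁻¹ |V_{ik}|²`, and
the dyadic-class bookkeeping `λ_k < 4^{clog₄ W_i + 2} < 64 W_i` feeding the weighted local Weyl law of part 1.
The registered stub `stub_abstractCLR` is then `abstractCLR_of stub_staircase stub_besselCount` (both landed).
Pure theorem file; Mathlib + part 1 (`…AbstractCLRAux`) + the two landed engine stubs.
-/

namespace Summit.QuantumFields.QCD.Cruxes.ActionBoundsLowModes.DropTheWilsonSquare

open Matrix Summit.QuantumFields.QCD.Theorems.HeatSlicedQuarks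
open scoped ComplexOrder

/-! ## Birman–Schwinger vectors and the abstract CLR bound -/

section Assembly

variable {n : Type*} [Fintype n]

omit [Fintype n] in
/-- Pointwise: `‖a + b‖² ≤ ‖a‖² + ‖b‖² + 2‖a‖‖b‖`. -/
private theorem clr_norm_add_sq_le (a b : ℂ) : ‖a + b‖ ^ 2 ≤ ‖a‖ ^ 2 + ‖b‖ ^ 2 + 2 * (‖a‖ * ‖b‖) := by
  calc ‖a + b‖ ^ 2 ≤ (‖a‖ + ‖b‖) ^ 2 := pow_le_pow_left₀ (norm_nonneg _) (norm_add_le a b) 2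
    _ = ‖a‖ ^ 2 + ‖b‖ ^ 2 + 2 * (‖a‖ * ‖b‖) := by ring

/-- **Minkowski in `ℓ²(n, ℂ)`**: `√(Σ‖x i + y i‖²) ≤ √(Σ‖x i‖²) + √(Σ‖y i‖²)`. -/
theorem clr_sqrt_sum_norm_sq_add_le (x y : n → ℂ) :
    Real.sqrt (∑ i, ‖x i + y i‖ ^ 2) ≤ Real.sqrt (∑ i, ‖x i‖ ^ 2) + Real.sqrt (∑ i, ‖y i‖ ^ 2) := by
  have hA : 0 ≤ ∑ i, ‖x i‖ ^ 2 := Finset.sum_nonneg fun _ _ => by positivity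
  have hB : 0 ≤ ∑ i, ‖y i‖ ^ 2 := Finset.sum_nonneg fun _ _ => by positivity
  have hCS : ∑ i, ‖x i‖ * ‖y i‖ ≤ Real.sqrt (∑ i, ‖x i‖ ^ 2) * Real.sqrt (∑ i, ‖y i‖ ^ 2) :=
    Real.sum_mul_le_sqrt_mul_sqrt _ _ _
  have hsum : ∑ i, ‖x i + y i‖ ^ 2 ≤
      ∑ i, ‖x i‖ ^ 2 + ∑ i, ‖y i‖ ^ 2 + 2 * ∑ i, ‖x i‖ * ‖y i‖ := by
    have h := Finset.sum_le_sum fun i (_ : i ∈ Finset.univ) => clr_norm_add_sq_le (x i) (y i)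
    rw [Finset.sum_add_distrib, Finset.sum_add_distrib, ← Finset.mul_sum] at h
    exact h
  have hsq : ∑ i, ‖x i + y i‖ ^ 2 ≤ (Real.sqrt (∑ i, ‖x i‖ ^ 2) + Real.sqrt (∑ i, ‖y i‖ ^ 2)) ^ 2 := by
    rw [add_sq, Real.sq_sqrt hA, Real.sq_sqrt hB]
    nlinarith [hsum, hCS]
  calc Real.sqrt (∑ i, ‖x i + y i‖ ^ 2)
      ≤ Real.sqrt ((Real.sqrt (∑ i, ‖x i‖ ^ 2) + Real.sqrt (∑ i, ‖y i‖ ^ 2)) ^ 2) := Real.sqrt_le_sqrt hsq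
    _ = Real.sqrt (∑ i, ‖x i‖ ^ 2) + Real.sqrt (∑ i, ‖y i‖ ^ 2) := Real.sqrt_sq (by positivity)

omit [Fintype n] in
/-- If `√Q ≤ ½√Q + √P` with `Q, P ≥ 0` then `Q ≤ 4P`. -/
private theorem clr_le_four_mul_of_sqrt {Q P : ℝ} (hQ : 0 ≤ Q) (hP : 0 ≤ P)
    (h : Real.sqrt Q ≤ Real.sqrt Q / 2 + Real.sqrt P) : Q ≤ 4 * P := by
  have h1 : Real.sqrt Q ≤ 2 * Real.sqrt P := by linarith
  have h2 : Real.sqrt Q ^ 2 ≤ (2 * Real.sqrt P) ^ 2 :=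
    pow_le_pow_left₀ (Real.sqrt_nonneg _) h1 2
  rw [Real.sq_sqrt hQ, mul_pow, Real.sq_sqrt hP] at h2
  linarith

variable [DecidableEq n]

/-- `zpow` bookkeeping for the dyadic classes: if `¬ (c + 2 ≤ m)` with `m = Int.log 4 λ`, `c = Int.clog 4 W`
then `λ < 4^{c+2}`. -/
theorem clr_class_lt {lam W : ℝ} (h : ¬ (Int.clog 4 W + 2 ≤ Int.log 4 lam)) :
    lam < (4 : ℝ) ^ (Int.clog 4 W + 2) := by
  have hb : 1 < (4 : ℕ) := by norm_num
  push Not at h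
  have h1 : lam < ((4 : ℕ) : ℝ) ^ (Int.log 4 lam + 1) := Int.lt_zpow_succ_log_self hb lam
  have h2 : ((4 : ℕ) : ℝ) ^ (Int.log 4 lam + 1) ≤ ((4 : ℕ) : ℝ) ^ (Int.clog 4 W + 2) :=
    zpow_le_zpow_right₀ (by norm_num) (by omega)
  have h3 := h1.trans_le h2
  simpa using h3

/-- `4^{clog₄ W + 2} < 64 W` for `W > 0`. -/
theorem clr_class_W {W : ℝ} (hW : 0 < W) : (4 : ℝ) ^ (Int.clog 4 W + 2) < 64 * W := by
  have hb : 1 < (4 : ℕ) := by norm_num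
  have h1 : ((4 : ℕ) : ℝ) ^ (Int.clog 4 W - 1) < W := Int.zpow_pred_clog_lt_self hb hW
  have h2 : (4 : ℝ) ^ (Int.clog 4 W + 2) = (4 : ℝ) ^ (Int.clog 4 W - 1) * 64 := by
    rw [show Int.clog 4 W + 2 = (Int.clog 4 W - 1) + 3 by ring, zpow_add₀ (by norm_num : (4 : ℝ) ≠ 0)]
    norm_num
  rw [h2]
  have h1' : (4 : ℝ) ^ (Int.clog 4 W - 1) < W := by simpa using h1
  linarith

set_option maxHeartbeats 1600000 in
/-- **The abstract CLR inequality from the two engine stubs** (`stub_staircase`, `stub_besselCount`, taken as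
hypotheses so that this file is independent of their landing): there is an absolute `c₁` (here `16384`) such
that for every positive definite `T` with the resolvent local Weyl law `Re((T+E)⁻¹)⁴(i,i) ≤ K/E²` (`E > 0`),
every weight `W > 0` and every subspace `F` on which `Re⟨u,Tu⟩ ≤ Σ_i W_i |u_i|²`, `dim F ≤ c₁ K Σ_i W_i²`.
Proof: Birman–Schwinger vectors `g = T^{1/2} u`; `√W u = Φ_hi u + Φ_lo u` with `‖Φ_hi u‖ ≤ ½‖g‖`
(staircase), hence `‖g‖² ≤ 4‖B_lo g‖²` on `G = T^{1/2} F` with `B_lo g = Φ_lo u`; Hilbert–Schmidt counting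
gives `dim F = dim G ≤ 4‖B_lo‖²_HS = 4 Σ_i W_i Σ_{k low} λ_k⁻¹|V_{ik}|² ≤ 4·64K·64 Σ_i W_i²`
(weighted local Weyl law at `Λ_i = 4^{clog₄ W_i + 2} < 64 W_i`). -/
theorem abstractCLR_of
    (hstair : ∀ {n : Type} [Fintype n] [DecidableEq n] (T : Matrix n n ℂ) (hT : T.PosDef) (W : n → ℝ),
      (∀ i, 0 < W i) → ∀ (u : n → ℂ),
        ∑ i, ‖(Real.sqrt (W i) : ℂ) *
            ∑ k, (if Int.clog 4 (W i) + 2 ≤ Int.log 4 (hT.1.eigenvalues k) then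
              (hT.1.eigenvectorUnitary : Matrix n n ℂ) i k *
                ((star (hT.1.eigenvectorUnitary : Matrix n n ℂ)) *ᵥ u) k else 0)‖ ^ 2 ≤
          (1 / 4 : ℝ) * (star u ⬝ᵥ (T *ᵥ u)).re)
    (hbessel : ∀ {n : Type} [Fintype n] [DecidableEq n] (M : Matrix n n ℂ) (G : Submodule ℂ (n → ℂ)),
      (∀ g ∈ G, ∑ i, ‖g i‖ ^ 2 ≤ 4 * ∑ i, ‖(M *ᵥ g) i‖ ^ 2) →
        (Module.finrank ℂ G : ℝ) ≤ 4 * ∑ i, ∑ j, ‖M i j‖ ^ 2) :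
    ∃ c₁ : ℝ, ∀ {n : Type} [Fintype n] [DecidableEq n] (T : Matrix n n ℂ), T.PosDef → ∀ (K : ℝ), 0 ≤ K →
      (∀ E : ℝ, 0 < E → ∀ i : n, ((((T + (E : ℂ) • (1 : Matrix n n ℂ))⁻¹) ^ 4) i i).re ≤ K / E ^ 2) →
      ∀ (W : n → ℝ), (∀ i, 0 < W i) →
      ∀ (F : Submodule ℂ (n → ℂ)),
        (∀ u ∈ F, (star u ⬝ᵥ (T *ᵥ u)).re ≤ ∑ i, W i * ‖u i‖ ^ 2) →
        (Module.finrank ℂ F : ℝ) ≤ c₁ * K * ∑ i, W i ^ 2 := by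
  refine ⟨16384, ?_⟩
  intro n _ _ T hT K hK hLW W hW F hF
  classical
  -- spectral data
  set V : Matrix n n ℂ := (hT.1.eigenvectorUnitary : Matrix n n ℂ) with hVdef
  set lam : n → ℝ := hT.1.eigenvalues with hlamdef
  have hpos : ∀ k, 0 < lam k := fun k => hT.eigenvalues_pos k
  have hVV : star V * V = 1 := clr_star_V_mul_V hT.1
  have hVV' : V * star V = 1 := clr_V_mul_star_V hT.1
  have hsq : ∀ k, 0 < Real.sqrt (lam k) := fun k => Real.sqrt_pos.mpr (hpos k)
  -- the square root `S = V diag(√λ) V⋆` and its inverse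
  set Smat : Matrix n n ℂ := V * diagonal (fun k => (Real.sqrt (lam k) : ℂ)) * star V with hSdef
  set Sinv : Matrix n n ℂ := V * diagonal (fun k => (((Real.sqrt (lam k))⁻¹ : ℝ) : ℂ)) * star V with hSinvdef
  have hdiag1 : diagonal (fun k => (Real.sqrt (lam k) : ℂ)) * diagonal (fun k => (((Real.sqrt (lam k))⁻¹ : ℝ) : ℂ))
      = 1 := by
    rw [diagonal_mul_diagonal, ← diagonal_one]
    congr 1
    funext k
    rw [← Complex.ofReal_mul, mul_inv_cancel₀ (hsq k).ne', Complex.ofReal_one]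
  have hdiag2 : diagonal (fun k => (((Real.sqrt (lam k))⁻¹ : ℝ) : ℂ)) * diagonal (fun k => (Real.sqrt (lam k) : ℂ))
      = 1 := by
    rw [diagonal_mul_diagonal, ← diagonal_one]
    congr 1
    funext k
    rw [← Complex.ofReal_mul, inv_mul_cancel₀ (hsq k).ne', Complex.ofReal_one]
  have hSSinv : Smat * Sinv = 1 := by
    rw [hSdef, hSinvdef]
    simp only [Matrix.mul_assoc]
    rw [← Matrix.mul_assoc (star V) V, hVV, Matrix.one_mul, ← Matrix.mul_assoc (diagonal _) (diagonal _),
      hdiag1, Matrix.one_mul, hVV']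
  have hSinvS : Sinv * Smat = 1 := by
    rw [hSdef, hSinvdef]
    simp only [Matrix.mul_assoc]
    rw [← Matrix.mul_assoc (star V) V, hVV, Matrix.one_mul, ← Matrix.mul_assoc (diagonal _) (diagonal _),
      hdiag2, Matrix.one_mul, hVV']
  let hInv : Invertible Smat := ⟨Sinv, hSinvS, hSSinv⟩
  set e : (n → ℂ) ≃ₗ[ℂ] (n → ℂ) := Smat.toLinearEquiv' hInv with hedef
  have he : ∀ u, e u = Smat *ᵥ u := fun u => by
    rw [hedef]
    show (Matrix.toLin' Smat) u = Smat *ᵥ u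
    exact Matrix.toLin'_apply Smat u
  -- coefficients in the eigenbasis
  have hcoef : ∀ u, star V *ᵥ (Smat *ᵥ u) =
      diagonal (fun k => (Real.sqrt (lam k) : ℂ)) *ᵥ (star V *ᵥ u) := fun u => by
    rw [hSdef, mulVec_mulVec, mulVec_mulVec, ← Matrix.mul_assoc, ← Matrix.mul_assoc, hVV, Matrix.one_mul,
      ← mulVec_mulVec]
  -- `‖S u‖² = Re⟨u,Tu⟩`
  have hnormS : ∀ u, ∑ i, ‖(Smat *ᵥ u) i‖ ^ 2 = (star u ⬝ᵥ (T *ᵥ u)).re := fun u => by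
    rw [← clr_sum_norm_sq_star_V_mulVec hT.1 (Smat *ᵥ u), ← hVdef, hcoef u, clr_re_quadForm_eq hT.1, ← hVdef,
      ← hlamdef]
    refine Finset.sum_congr rfl fun k _ => ?_
    rw [mulVec_diagonal, norm_mul, mul_pow, Complex.norm_real, Real.norm_of_nonneg (hsq k).le,
      Real.sq_sqrt (hpos k).le]
  -- the low-energy Birman–Schwinger matrix
  set Blo : Matrix n n ℂ := Matrix.of fun i j => (Real.sqrt (W i) : ℂ) *
    ∑ k, (if Int.clog 4 (W i) + 2 ≤ Int.log 4 (lam k) then 0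
      else V i k * (((Real.sqrt (lam k))⁻¹ : ℝ) : ℂ) * star (V j k)) with hBlodef
  -- `B_lo (S u) = Φ_lo u`
  have hBloS : ∀ u i, (Blo *ᵥ (Smat *ᵥ u)) i = (Real.sqrt (W i) : ℂ) *
      ∑ k, (if Int.clog 4 (W i) + 2 ≤ Int.log 4 (lam k) then 0 else V i k * (star V *ᵥ u) k) := by
    intro u i
    have hc : ∀ k, (star V *ᵥ (Smat *ᵥ u)) k = (Real.sqrt (lam k) : ℂ) * (star V *ᵥ u) k := fun k => by
      rw [hcoef u, mulVec_diagonal]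
    have hsv : ∀ k, ∑ x, star (V x k) * (Smat *ᵥ u) x = (Real.sqrt (lam k) : ℂ) * (star V *ᵥ u) k := by
      intro k
      rw [← hc k, mulVec, dotProduct]
      refine Finset.sum_congr rfl fun j _ => ?_
      rw [star_apply]
    rw [mulVec, dotProduct]
    simp only [hBlodef, Matrix.of_apply]
    simp_rw [Finset.mul_sum, Finset.sum_mul]
    rw [Finset.sum_comm]
    refine Finset.sum_congr rfl fun k _ => ?_
    by_cases hk : Int.clog 4 (W i) + 2 ≤ Int.log 4 (lam k)
    · simp_rw [if_pos hk]
      simp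
    · simp_rw [if_neg hk]
      have hone : (((Real.sqrt (lam k))⁻¹ : ℝ) : ℂ) * (Real.sqrt (lam k) : ℂ) = 1 := by
        rw [← Complex.ofReal_mul, inv_mul_cancel₀ (hsq k).ne', Complex.ofReal_one]
      calc ∑ x, (Real.sqrt (W i) : ℂ) * (V i k * (((Real.sqrt (lam k))⁻¹ : ℝ) : ℂ) * star (V x k)) *
              (Smat *ᵥ u) x
          = (Real.sqrt (W i) : ℂ) * (V i k * (((Real.sqrt (lam k))⁻¹ : ℝ) : ℂ)) *
              ∑ x, star (V x k) * (Smat *ᵥ u) x := by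
            rw [Finset.mul_sum]
            exact Finset.sum_congr rfl fun x _ => by ring
        _ = (Real.sqrt (W i) : ℂ) * (V i k * (star V *ᵥ u) k) := by
            rw [hsv k]
            calc (Real.sqrt (W i) : ℂ) * (V i k * (((Real.sqrt (lam k))⁻¹ : ℝ) : ℂ)) *
                  ((Real.sqrt (lam k) : ℂ) * (star V *ᵥ u) k)
                = (Real.sqrt (W i) : ℂ) * (V i k * (star V *ᵥ u) k) *
                    ((((Real.sqrt (lam k))⁻¹ : ℝ) : ℂ) * (Real.sqrt (lam k) : ℂ)) := by ring
              _ = (Real.sqrt (W i) : ℂ) * (V i k * (star V *ᵥ u) k) := by rw [hone, mul_one]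
  -- the subspace `G = S(F)` and the counting hypothesis on it
  set G : Submodule ℂ (n → ℂ) := F.map (e : (n → ℂ) →ₗ[ℂ] (n → ℂ)) with hGdef
  have hfin : Module.finrank ℂ G = Module.finrank ℂ F := LinearEquiv.finrank_map_eq e F
  have hG : ∀ g ∈ G, ∑ i, ‖g i‖ ^ 2 ≤ 4 * ∑ i, ‖(Blo *ᵥ g) i‖ ^ 2 := by
    intro g hg
    rw [hGdef, Submodule.mem_map] at hg
    obtain ⟨u, hu, rfl⟩ := hg
    have heu : (e : (n → ℂ) →ₗ[ℂ] (n → ℂ)) u = Smat *ᵥ u := he u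
    rw [heu]
    -- `Q = ‖S u‖² = Re⟨u,Tu⟩`, `P = ‖Φ_lo u‖²`
    set c := star V *ᵥ u with hcdef
    set Q : ℝ := (star u ⬝ᵥ (T *ᵥ u)).re with hQdef
    have hQ0 : 0 ≤ Q := clr_re_quadForm_nonneg hT.1 (fun k => (hpos k).le) u
    set Φhi : n → ℂ := fun i => (Real.sqrt (W i) : ℂ) *
      ∑ k, (if Int.clog 4 (W i) + 2 ≤ Int.log 4 (lam k) then V i k * c k else 0) with hΦhidef
    set Φlo : n → ℂ := fun i => (Real.sqrt (W i) : ℂ) *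
      ∑ k, (if Int.clog 4 (W i) + 2 ≤ Int.log 4 (lam k) then 0 else V i k * c k) with hΦlodef
    have hsplit : ∀ i, Φhi i + Φlo i = (Real.sqrt (W i) : ℂ) * u i := fun i => by
      simp only [hΦhidef, hΦlodef]
      rw [← mul_add, ← Finset.sum_add_distrib]
      congr 1
      have hu' : u i = (V *ᵥ c) i := by rw [hcdef, clr_V_mulVec_star_V_mulVec hT.1]
      rw [hu', mulVec, dotProduct]
      refine Finset.sum_congr rfl fun k _ => ?_
      split_ifs <;> simp
    have hhi : ∑ i, ‖Φhi i‖ ^ 2 ≤ (1 / 4 : ℝ) * Q := hstair T hT W hW u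
    have hlo : ∀ i, (Blo *ᵥ (Smat *ᵥ u)) i = Φlo i := fun i => hBloS u i
    have hWu : ∑ i, W i * ‖u i‖ ^ 2 = ∑ i, ‖Φhi i + Φlo i‖ ^ 2 := by
      refine Finset.sum_congr rfl fun i _ => ?_
      rw [hsplit i, norm_mul, mul_pow, Complex.norm_real, Real.norm_of_nonneg (Real.sqrt_nonneg _),
        Real.sq_sqrt (hW i).le]
    -- Minkowski: `√Q ≤ √(Σ W|u|²) ≤ √(Q/4) + √P`
    have hP : ∑ i, ‖(Blo *ᵥ (Smat *ᵥ u)) i‖ ^ 2 = ∑ i, ‖Φlo i‖ ^ 2 :=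
      Finset.sum_congr rfl fun i _ => by rw [hlo i]
    rw [hnormS u, hP]
    refine clr_le_four_mul_of_sqrt hQ0 (Finset.sum_nonneg fun _ _ => by positivity) ?_
    have h1 : Real.sqrt Q ≤ Real.sqrt (∑ i, ‖Φhi i + Φlo i‖ ^ 2) := by
      rw [← hWu]
      exact Real.sqrt_le_sqrt (hF u hu)
    have h2 := clr_sqrt_sum_norm_sq_add_le Φhi Φlo
    have h3 : Real.sqrt (∑ i, ‖Φhi i‖ ^ 2) ≤ Real.sqrt Q / 2 := by
      calc Real.sqrt (∑ i, ‖Φhi i‖ ^ 2) ≤ Real.sqrt ((1 / 4 : ℝ) * Q) := Real.sqrt_le_sqrt hhi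
        _ = Real.sqrt Q / 2 := by
            rw [Real.sqrt_mul (by norm_num), show (1 / 4 : ℝ) = (1 / 2) ^ 2 by norm_num,
              Real.sqrt_sq (by norm_num)]
            ring
    linarith
  -- Hilbert–Schmidt counting
  have hcount : (Module.finrank ℂ G : ℝ) ≤ 4 * ∑ i, ∑ j, ‖Blo i j‖ ^ 2 := hbessel Blo G hG
  -- row norms of `B_lo`
  have hrow : ∀ i, ∑ j, ‖Blo i j‖ ^ 2 = W i * ∑ k, (if Int.clog 4 (W i) + 2 ≤ Int.log 4 (lam k) then 0
      else (lam k)⁻¹ * ‖V i k‖ ^ 2) := by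
    intro i
    set d : n → ℂ := fun k => if Int.clog 4 (W i) + 2 ≤ Int.log 4 (lam k) then 0
      else V i k * (((Real.sqrt (lam k))⁻¹ : ℝ) : ℂ) with hddef
    have hentry : ∀ j, Blo i j = (Real.sqrt (W i) : ℂ) * star ((V *ᵥ star d) j) := fun j => by
      simp only [hBlodef, Matrix.of_apply]
      congr 1
      rw [mulVec, dotProduct, star_sum]
      refine Finset.sum_congr rfl fun k _ => ?_
      simp only [hddef, Pi.star_apply]
      split_ifs with hk
      · simp
      · rw [star_mul, star_star, mul_comm]
    have h1 : ∑ j, ‖Blo i j‖ ^ 2 = W i * ∑ j, ‖(V *ᵥ star d) j‖ ^ 2 := by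
      rw [Finset.mul_sum]
      refine Finset.sum_congr rfl fun j _ => ?_
      rw [hentry j, norm_mul, norm_star, mul_pow, Complex.norm_real, Real.norm_of_nonneg (Real.sqrt_nonneg _),
        Real.sq_sqrt (hW i).le]
    rw [h1, clr_sum_norm_sq_V_mulVec hT.1]
    congr 1
    refine Finset.sum_congr rfl fun k _ => ?_
    simp only [hddef, Pi.star_apply]
    split_ifs with hk
    · simp
    · rw [norm_star, norm_mul, mul_pow, Complex.norm_real,
        Real.norm_of_nonneg (inv_nonneg.mpr (hsq k).le), inv_pow, Real.sq_sqrt (hpos k).le, mul_comm]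
  -- the low-energy sums are controlled by the weighted local Weyl law
  have hlow : ∀ i, ∑ k, (if Int.clog 4 (W i) + 2 ≤ Int.log 4 (lam k) then 0 else (lam k)⁻¹ * ‖V i k‖ ^ 2) ≤
      64 * K * (64 * W i) := by
    intro i
    set Λ : ℝ := (4 : ℝ) ^ (Int.clog 4 (W i) + 2) with hΛdef
    have hΛ0 : 0 < Λ := zpow_pos (by norm_num) _
    have hΛW : Λ < 64 * W i := clr_class_W (hW i)
    have h1 : ∑ k, (if Int.clog 4 (W i) + 2 ≤ Int.log 4 (lam k) then 0 else (lam k)⁻¹ * ‖V i k‖ ^ 2) ≤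
        ∑ k, (if lam k < Λ then (lam k)⁻¹ * ‖V i k‖ ^ 2 else 0) := by
      refine Finset.sum_le_sum fun k _ => ?_
      have hposk := hpos k
      by_cases hk : Int.clog 4 (W i) + 2 ≤ Int.log 4 (lam k)
      · rw [if_pos hk]
        split_ifs <;> positivity
      · rw [if_neg hk, if_pos (clr_class_lt hk)]
    have h2 := weightedLocalWeyl hT hLW hΛ0 i
    calc _ ≤ _ := h1
      _ ≤ 64 * K * Λ := h2
      _ ≤ 64 * K * (64 * W i) := mul_le_mul_of_nonneg_left hΛW.le (by positivity)
  -- assemble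
  calc (Module.finrank ℂ F : ℝ) = (Module.finrank ℂ G : ℝ) := by rw [hfin]
    _ ≤ 4 * ∑ i, ∑ j, ‖Blo i j‖ ^ 2 := hcount
    _ = 4 * ∑ i, W i * ∑ k, (if Int.clog 4 (W i) + 2 ≤ Int.log 4 (lam k) then 0
          else (lam k)⁻¹ * ‖V i k‖ ^ 2) := by
        congr 1
        exact Finset.sum_congr rfl fun i _ => hrow i
    _ ≤ 4 * ∑ i, W i * (64 * K * (64 * W i)) := by
        gcongr with i
        · exact (hW i).le
        · exact hlow i
    _ = 16384 * K * ∑ i, W i ^ 2 := by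
        rw [Finset.mul_sum, Finset.mul_sum]
        refine Finset.sum_congr rfl fun i _ => ?_
        ring

end Assembly

/-! ## The registered stub -/

/-- **Stub C1 (`stub_abstractCLR`, the lead's stub: abstract finite-dimensional CLR inequality,
Cwikel–Birman–Schwinger form).**  There is an absolute `c₁` such that: for every finite index type,
every positive definite `T` whose resolvent obeys the local Weyl law `Re((T+E)⁻¹)⁴(i,i) ≤ K/E²`
for all `E > 0` and all `i` (with `K ≥ 0`), every weight `W > 0` and every subspace `F` on which
`Re⟨u,Tu⟩ ≤ Σ_i W_i |u_i|²`, one has `dim F ≤ c₁ · K · Σ_i W_i²`.  It is `abstractCLR_of` fed with the two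
landed engine stubs `stub_staircase` and `stub_besselCount`. -/
theorem stub_abstractCLR :
    ∃ c₁ : ℝ, ∀ {n : Type} [Fintype n] [DecidableEq n] (T : Matrix n n ℂ), T.PosDef → ∀ (K : ℝ), 0 ≤ K →
      (∀ E : ℝ, 0 < E → ∀ i : n, ((((T + (E : ℂ) • (1 : Matrix n n ℂ))⁻¹) ^ 4) i i).re ≤ K / E ^ 2) →
      ∀ (W : n → ℝ), (∀ i, 0 < W i) →
      ∀ (F : Submodule ℂ (n → ℂ)),
        (∀ u ∈ F, (star u ⬝ᵥ (T *ᵥ u)).re ≤ ∑ i, W i * ‖u i‖ ^ 2) →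
        (Module.finrank ℂ F : ℝ) ≤ c₁ * K * ∑ i, W i ^ 2 :=
  abstractCLR_of stub_staircase stub_besselCount

end Summit.QuantumFields.QCD.Cruxes.ActionBoundsLowModes.DropTheWilsonSquare
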